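import Summits.BirchSwinnertonDyer.BirchSwinnertonDyer.Theorems.ByReductionTypeAtTwoMultSelmerRankDisplay
import HarnessLib

/-!
# Route `ByReductionTypeAtTwo`, children `MultLowerHalfAtTwo` (item stmt-BirchSwinnertonDyer-19923) / `MultUpperHalfAtTwo`
# (19922): the KATO-SIDE FALSIFICATION TEST of the multiplicative pinch as a KERNEL theorem — T-KATO2-NSMULT
# + `λ_an = n` + `μ_an = 0` (+ PRINT Prop. 4.14@2, Česnavičius) BOUND every layer count: `#Sel_{2^∞}(E/ℚ_j)[2] ≤ 2^n`

HONEST FRAMING (cell `bsd-2adic`, run/shared/lean/pub/bsd-2adic/, seat `bsd-2adic-mult-3` GEN 6, HUMAN RULINGS D-0036 /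
D-0054 / D-0074 row (A)): research route; THEOREMS ONLY — no definition, nothing asserted, nothing booked; BSD is not proved by
any of this. PARTITION (D-0054): X5@2 mult, `E[2]` irreducible ∧ `ρ_{E,2^∞}` surjective ∧ `Δ < 0` (K4ᵐ, B1·O1; the 808 NS classes
of CENSUS-6) × p = 2 — types-the-object-of (a typed refutation hook for the MEMO binder T-KATO2-NSMULT at a class);
closes none.

WHY. The doors `MultSelmerRank.bsdp_two_nonsplit_of_katoInt_display` (p447774) consume the LOWER count
`2^n ≤ #Sel_{2^∞}(E/ℚ_j)[2]` with `n = λ_an`. The SAME inputs bound every layer count FROM ABOVE: Kato's divisibility with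
the `2`-power part (`hKint`: `char_Λ X ∣ L₀`, `ι L₀ = ϖ·L₂`) and the analytic certificates give `μ(X) = 0` and
`λ(X) ≤ λ(L₀) = n` (`μ`, `λ` are additive on `Λ ∖ {0}`: `mu_le_mu_mul`, `lam_mul`), Prop. 4.14@2 makes `X ≅ ℤ₂^{λ(X)}`, and
Greenberg's injective map `s_j` (`E(ℚ_∞)[2] = 0`) gives `#Sel_{2^∞}(E/ℚ_j)[2] ≤ #X/(2,T^{2^j})X ≤ #X/2X = 2^{λ(X)} ≤ 2^n`.
So the layer tables of the engines (HOME/mult3/sel2layer-k4/: `d_j ≤ n` on 804/804 rank-`0` rows, 0 violations) are a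
FALSIFICATION TEST of the conjunction {T-KATO2-NSMULT at `W`, `λ_an = n`, `μ_an = 0`, PRINT}: ONE certified layer count
`d_j > λ_an` at a surjective non-split `Δ < 0` curve refutes it — typed here for the cdisprove / referee seats. The statement
is made for the CONSTRUCTED cyclotomic `ℤ₂`-extension `CyclotomicZp.zpExtension 2` (`κ_cyc = ℓ ∘ χ₂`, with its normalised
topological generator, `exists_isTopGenerator_zpExtension`), whose `j`-th layer is `ℚ_j` (`ℚ(√2)`, `ℚ(ζ₁₆)⁺`, …).

* §1 `natCard_selmerLayer_twoTorsion_le_of_katoInt` — the bound with `hper₀` displayed;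
  `natCard_selmerLayer_twoTorsion_le_of_katoInt_display` — `hper₀` discharged by Česnavičius (`hC`).
Nothing here is new mathematics: it is the `λ`-half of the pinch read as an inequality (Greenberg–Vatsal 2000 p. 4;
Greenberg LNM 1716 §1 p. 60, Prop. 4.14). References as in the companion files.
-/

set_option autoImplicit false
set_option linter.dupNamespace false

noncomputable section

open scoped Classical MatrixGroups ModularForm

open CongruenceSubgroup WeierstrassCurve Literature.NumberTheory.EllipticCurves
  Literature.NumberTheory.EllipticCurves.ModularForms
  Literature.NumberTheory.EllipticCurves.Greenberg1999
  Literature.NumberTheory.EllipticCurves.Rank1Residual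
  Literature.NumberTheory.EllipticCurves.Rank1Residual.Typed Summit.BirchSwinnertonDyer.Rank1Residual
  Summit.BirchSwinnertonDyer.Rank1Residual.X5 Summit.BirchSwinnertonDyer.Rank1Residual.X5.O1
  Summit.BirchSwinnertonDyer.Rank1Residual.X5.TowerGap
  Summit.BirchSwinnertonDyer.Rank1Residual.X1.MuLambda Summit.BirchSwinnertonDyer.Rank1Residual.X1.MuPart
  Summit.BirchSwinnertonDyer.Rank1Residual.X1.ParitySqueeze
  Summit.BirchSwinnertonDyer.BirchSwinnertonDyer.Theorems.KatoHalfPinch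

namespace Summit.BirchSwinnertonDyer.BirchSwinnertonDyer.Theorems.MultSelmerRank

variable (W : WeierstrassCurve ℚ) [W.IsElliptic] [W.IsGloballyMinimal]

/-- **KATO-SIDE TEST (non-split): every layer count is at most `2^{λ_an}`.** For `W/ℚ` globally minimal, NON-SPLIT
multiplicative at `2`, `ρ_{E,2^∞}` surjective, `Δ < 0`: T-KATO2-NSMULT (`hKint`, MEMO) + modularity + Prop. 4.14@2 (`h414`)
+ the period datum `hper₀` + the certificates `λ_an(E) = n` (`hlan`), `μ_an(E) = 0` (`hμan`) ⟹ for every layer `j` of the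
constructed cyclotomic `ℤ₂`-extension, `#Sel_{2^∞}(E/ℚ_j)[2] ≤ 2^n`. Chain: `hKint` ⇒ `X` torsion, `L₀ ∈ char X = (f_X)`,
`L₀ = f_X·b`; `μ(L₀) = 0 ⇒ μ(f_X) = 0 = μ(X)`; `λ(f_X) + λ(b) = λ(L₀) = n ⇒ λ(X) ≤ n`; Prop. 4.14 ⇒ `#X/2X = 2^{λ(X)}`;
`#Sel_{2^∞}(E/ℚ_j)[2] ≤ #X/(2,T^{2^j})X ≤ #X/2X`. A certified count above `2^n` REFUTES the displayed conjunction at `W`.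
[cite: GreenbergVatsal2000, p. 4 (after Thm. (1.2))] [cite: GreenbergLNM1716, §1 p. 60, §3 pp. 85–86 and Prop. 4.14 (p. 124)]
[cite: Kato2004Asterisque, Thm. 17.4 (p. 273) (shape)] [cite: Washington1997, §13.1–13.2] -/
theorem natCard_selmerLayer_twoTorsion_le_of_katoInt {n : ℕ}
    (hmod : nonempty_modularParametrizationData)
    (h414 : prop414_noFiniteSubmodule_of_not_dvd_torsionOrder)
    (hKint : KatoDivisibilityAtTwoNonsplitMultInt W)
    (hper₀ : ∀ [NeZero (W.conductorNorm ℤ)] (f : CuspForm (Gamma0 (W.conductorNorm ℤ)) 2),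
      IsNewformOf W f → ∀ ϖ : ℚ, (ϖ : ℝ) * W.realPeriodRat = plusPeriod f → 0 ≤ padicValRat 2 ϖ)
    (hmult : Mult W 2) (hns : ¬ W.HasSplitMultiplicativeReductionAtPrime 2)
    (him : TwoAdicSurjective W) (hΔ : W.Δ < 0)
    (hlan : X2.AnalyticLambdaEq W 2 n) (hμan : X2.AnalyticMuLE W 2 0) (j : ℕ) :
    Nat.card {z : W.selmerLayer (CyclotomicZp.zpExtension 2) j // 2 • z = 0} ≤ 2 ^ n := by
  haveI : NeZero (W.conductorNorm ℤ) := ⟨(W.conductorNorm_pos_holds).ne'⟩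
  -- the cyclotomic datum on the constructed tower
  have hκ : (CyclotomicZp.zpExtension 2).IsCyclotomic := CyclotomicZp.isCyclotomic_zpExtension 2
  obtain ⟨γ, hγ, hχ⟩ := CyclotomicZp.exists_isTopGenerator_zpExtension 2
  have hγ' : IsCyclotomicVariable 2 γ := ⟨1, IsOfFinOrder.one, by rw [mul_one]; exact hχ⟩
  obtain ⟨D⟩ := W.nonempty_selmerDualData_holds (CyclotomicZp.zpExtension 2) γ hγ
  haveI : Module.Finite (IwasawaAlgebra 2) D.X := D.module_finite_holds hγ
  -- the newform, the period ratio, the `2`-adic `L`-function and its integral normalisation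
  obtain ⟨Dm⟩ := hmod W
  have hf : IsNewformOf W Dm.f := Dm.isNewformOf
  obtain ⟨ϖ, -, hϖ, -⟩ := Dm.exists_rat_mul_realPeriodRat_eq_plusPeriod
  obtain ⟨L, hLf⟩ := exists_isMultPAdicLFunctionOf_neg_one_of_nonsplit hf hmult hns
  obtain ⟨L₀, hL₀⟩ := exists_iwasawaToPowerSeries_eq_C_mul_of_isMultPAdicLFunctionOf_neg_one_two hf
    hmult hns (hper₀ Dm.f hf ϖ hϖ) hLf
  obtain ⟨hX, hKL₀⟩ := hKint hmult hns him hΔ Dm.f hf L hLf _ γ hκ hγ hγ' D ϖ hϖ L₀ hL₀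
  -- `μ(L₀) = 0`, `λ(L₀) = n`
  obtain ⟨k, hk⟩ := hμan Dm.f hf ϖ hϖ L (fun hsp => absurd hsp hns) (fun _ => hLf)
  rw [← hL₀] at hk
  have hμL₀ : mu L₀ = 0 := Nat.le_zero.mp (mu_le_of_lt_norm_coeff hk)
  have hL₀0 : L₀ ≠ 0 := by
    rintro rfl
    rw [map_zero, map_zero, norm_zero] at hk
    exact not_le.mpr hk (by positivity)
  have hlan' : lam L₀ = n := hlan Dm.f hf ϖ hϖ L (fun hsp => absurd hsp hns) (fun _ => hLf) L₀ hL₀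
  -- the generator `f_X` and the factorisation `L₀ = f_X · b`
  haveI : (Module.charIdeal (IwasawaAlgebra 2) D.X).IsPrincipal := charIdeal_isPrincipal_holds 2 D.X
  obtain ⟨fX, hfX⟩ := Submodule.IsPrincipal.principal (Module.charIdeal (IwasawaAlgebra 2) D.X)
  have hchar : D.charIdeal = Ideal.span {fX} := hfX
  have hfX0 : fX ≠ 0 := by
    intro h0
    refine Module.charIdeal_ne_bot (IwasawaAlgebra 2) D.X ?_
    change D.charIdeal = ⊥
    rw [hchar, h0]
    exact Ideal.span_singleton_eq_bot.mpr rfl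
  rw [hchar] at hKL₀
  obtain ⟨b, hb⟩ := Ideal.mem_span_singleton'.mp hKL₀
  have hfac : L₀ = fX * b := by rw [mul_comm, hb]
  have hb0 : b ≠ 0 := by rintro rfl; exact hL₀0 (by rw [hfac, mul_zero])
  -- `μ(X) = 0` and `λ(X) ≤ n`
  have hμfX : mu fX = 0 := by
    have h := mu_le_mu_mul hfX0 hb0
    rw [← hfac, hμL₀] at h
    exact Nat.le_zero.mp h
  have hμX : D.mu = 0 := by
    rw [SelmerDualData.mu, ← mu_generator_eq_muInvariant D.X hX hfX0 hchar]; exact hμfX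
  have hlamX : D.lambda ≤ n := by
    have h1 : lam fX = D.lambda := lam_generator_eq_lambdaInvariant D.X hX hfX0 hchar
    have h2 : lam L₀ = lam fX + lam b := by rw [hfac]; exact lam_mul hfX0 hb0
    have h3 : lam fX ≤ lam L₀ := by rw [h2]; exact Nat.le_add_right _ _
    rw [← h1, ← hlan']; exact h3
  -- Prop. 4.14@2: no finite submodule, so `#X/2X = 2^{λ(X)}`; then the layer chain
  have htors := not_two_dvd_torsionOrder_of_twoAdicSurjective W him
  have hnf : ∀ N : Submodule (IwasawaAlgebra 2) D.X, Finite N → N = ⊥ :=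
    fun N hN => h414 W 2 htors _ γ hκ hγ D hX N hN
  have hcard : Nat.card (D.X ⧸ (IwasawaAlgebra.augIdealP 2 • (⊤ : Submodule (IwasawaAlgebra 2) D.X))) =
      2 ^ lambdaInvariant 2 D.X :=
    Summit.BirchSwinnertonDyer.Rank1Residual.Additive.card_quotient_eq_pow_lambdaInvariant_holds 2 D.X hX hμX hnf
  have hfin : Finite (D.X ⧸ modPSubmodule 2 D.X) := TowerGap.finite_modP_of_isTorsion_of_mu_eq_zero 2 hX hμX
  have hle := TowerGap.natCard_quotient_towerIdeal_le_natCard_quotient_modP 2 hfin (2 ^ j)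
  have hmodP : Nat.card (D.X ⧸ modPSubmodule 2 D.X) = 2 ^ lambdaInvariant 2 D.X := hcard
  have hK := Iwasawa.forall_smul_eq_zero_imp_of_not_dvd_torsionOrder W htors
  have hsel := (finite_and_natCard_selmerLayer_pTorsion_le W (CyclotomicZp.zpExtension 2) D hK j).2
  calc Nat.card {z : W.selmerLayer (CyclotomicZp.zpExtension 2) j // 2 • z = 0}
      ≤ Nat.card (D.X ⧸ (towerIdeal 2 (2 ^ j) • ⊤ : Submodule (IwasawaAlgebra 2) D.X)) := hsel
    _ ≤ Nat.card (D.X ⧸ modPSubmodule 2 D.X) := hle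
    _ = 2 ^ lambdaInvariant 2 D.X := hmodP
    _ ≤ 2 ^ n := Nat.pow_le_pow_right (by norm_num) hlamX

/-- **KATO-SIDE TEST (non-split), DISPLAY FORM:** as `natCard_selmerLayer_twoTorsion_le_of_katoInt` with `hper₀` discharged by
Česnavičius (`hC`, companion `periodRatio_nonneg_of_twoAdicSurjective_of_cesnavicius`): PRINT {`hmod`, `h414`, `hC`} + MEMO
{T-KATO2-NSMULT} + CERT {`λ_an = n`, `μ_an = 0`} + decidable data ⟹ `#Sel_{2^∞}(E/ℚ_j)[2] ≤ 2^n` at every layer.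
[cite: GreenbergVatsal2000, p. 4] [cite: GreenbergLNM1716, Prop. 4.14 (p. 124)] [cite: Cesnavicius2018, Thm. 1.2] -/
theorem natCard_selmerLayer_twoTorsion_le_of_katoInt_display {n : ℕ}
    (hmod : nonempty_modularParametrizationData)
    (h414 : prop414_noFiniteSubmodule_of_not_dvd_torsionOrder)
    (hC : cesnavicius_not_two_dvd_maninConstant_of_two_dvd_level)
    (hKint : KatoDivisibilityAtTwoNonsplitMultInt W)
    (hmult : Mult W 2) (hns : ¬ W.HasSplitMultiplicativeReductionAtPrime 2)
    (him : TwoAdicSurjective W) (hΔ : W.Δ < 0)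
    (hlan : X2.AnalyticLambdaEq W 2 n) (hμan : X2.AnalyticMuLE W 2 0) (j : ℕ) :
    Nat.card {z : W.selmerLayer (CyclotomicZp.zpExtension 2) j // 2 • z = 0} ≤ 2 ^ n :=
  natCard_selmerLayer_twoTorsion_le_of_katoInt W hmod h414 hKint
    (periodRatio_nonneg_of_twoAdicSurjective_of_cesnavicius W hC hmult him) hmult hns him hΔ hlan hμan j


/-! ## §2 The split face of the test (T-KATO2-SPMULT; trivial zero peeled: `λ(X) ≤ λ_an − 1`) -/

/-- **KATO-SIDE TEST (split): every layer count is at most `2^n` when `λ_an = n + 1`.** For `W/ℚ` globally minimal, SPLIT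
multiplicative at `2`, `ρ_{E,2^∞}` surjective, `Δ < 0`: T-KATO2-SPMULT (`hKint`: `X` torsion, `g ∈ char X`, `ι(T·g) = ϖ·L₂`) +
modularity + Prop. 4.14@2 (`h414`) + the certificates `λ_an(E) = n + 1` (`hlan`, trivial zero included), `μ_an(E) = 0` (`hμan`) ⟹
`#Sel_{2^∞}(E/ℚ_j)[2] ≤ 2^n` at every layer `j` of the constructed cyclotomic `ℤ₂`-extension (`λ(T) = 1`, `μ(T) = 0`:
`X2.lam_X`, `X2.mu_X_eq_zero_and_pfree_X`; then as in §1 with `g = f_X·b`). No period datum (the split datum is integral by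
`hKint`). A certified count above `2^{λ_an − 1}` REFUTES the displayed conjunction at `W`.
[cite: GreenbergVatsal2000, p. 4 (after Thm. (1.2))] [cite: GreenbergLNM1716, §1 p. 60, §3 pp. 85–86 and Prop. 4.14 (p. 124)]
[cite: MazurTateTeitelbaum1986Invent, §I.14–15 (trivial zero)] [cite: Washington1997, §13.1–13.2] -/
theorem natCard_selmerLayer_twoTorsion_le_of_katoIntSplit {n : ℕ}
    (hmod : nonempty_modularParametrizationData)
    (h414 : prop414_noFiniteSubmodule_of_not_dvd_torsionOrder)
    (hKint : KatoDivisibilityAtTwoSplitMultInt W)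
    (hmult : Mult W 2) (hsp : W.HasSplitMultiplicativeReductionAtPrime 2)
    (him : TwoAdicSurjective W) (hΔ : W.Δ < 0)
    (hlan : X2.AnalyticLambdaEq W 2 (n + 1)) (hμan : X2.AnalyticMuLE W 2 0) (j : ℕ) :
    Nat.card {z : W.selmerLayer (CyclotomicZp.zpExtension 2) j // 2 • z = 0} ≤ 2 ^ n := by
  haveI : NeZero (W.conductorNorm ℤ) := ⟨(W.conductorNorm_pos_holds).ne'⟩
  have hκ : (CyclotomicZp.zpExtension 2).IsCyclotomic := CyclotomicZp.isCyclotomic_zpExtension 2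
  obtain ⟨γ, hγ, hχ⟩ := CyclotomicZp.exists_isTopGenerator_zpExtension 2
  have hγ' : IsCyclotomicVariable 2 γ := ⟨1, IsOfFinOrder.one, by rw [mul_one]; exact hχ⟩
  obtain ⟨D⟩ := W.nonempty_selmerDualData_holds (CyclotomicZp.zpExtension 2) γ hγ
  haveI : Module.Finite (IwasawaAlgebra 2) D.X := D.module_finite_holds hγ
  obtain ⟨Dm⟩ := hmod W
  have hf : IsNewformOf W Dm.f := Dm.isNewformOf
  obtain ⟨ϖ, -, hϖ, -⟩ := Dm.exists_rat_mul_realPeriodRat_eq_plusPeriod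
  obtain ⟨L, hLf⟩ := exists_isSplitMultPAdicLFunctionOf hsp hf
  obtain ⟨hX, g, hg, hι⟩ := hKint hmult hsp him hΔ Dm.f hf L hLf _ γ hκ hγ hγ' D ϖ hϖ
  -- `μ(T·g) = 0`, `λ(T·g) = n + 1`, hence `μ(g) = 0`, `λ(g) = n`
  obtain ⟨k, hk⟩ := hμan Dm.f hf ϖ hϖ L (fun _ => hLf) (fun hns => absurd hsp hns)
  rw [← hι] at hk
  have hμL₀ : mu (PowerSeries.X * g : IwasawaAlgebra 2) = 0 := Nat.le_zero.mp (mu_le_of_lt_norm_coeff hk)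
  have hL₀0 : (PowerSeries.X * g : IwasawaAlgebra 2) ≠ 0 := by
    intro h0
    rw [h0, map_zero, map_zero, norm_zero] at hk
    exact not_le.mpr hk (by positivity)
  have hX0 : (PowerSeries.X : IwasawaAlgebra 2) ≠ 0 := PowerSeries.X_ne_zero
  have hg0 : g ≠ 0 := by
    rintro rfl
    exact hL₀0 (mul_zero _)
  have hlan' : lam (PowerSeries.X * g : IwasawaAlgebra 2) = n + 1 :=
    hlan Dm.f hf ϖ hϖ L (fun _ => hLf) (fun hns => absurd hsp hns) _ hι
  have hlamg : lam g = n := by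
    rw [lam_mul hX0 hg0, X2.lam_X] at hlan'
    omega
  have hμg : mu g = 0 := by
    rw [mu_mul hX0 hg0, X2.mu_X_eq_zero_and_pfree_X.1] at hμL₀
    omega
  -- the generator `f_X` and `g = f_X · b`
  haveI : (Module.charIdeal (IwasawaAlgebra 2) D.X).IsPrincipal := charIdeal_isPrincipal_holds 2 D.X
  obtain ⟨fX, hfX⟩ := Submodule.IsPrincipal.principal (Module.charIdeal (IwasawaAlgebra 2) D.X)
  have hchar : D.charIdeal = Ideal.span {fX} := hfX
  have hfX0 : fX ≠ 0 := by
    intro h0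
    refine Module.charIdeal_ne_bot (IwasawaAlgebra 2) D.X ?_
    change D.charIdeal = ⊥
    rw [hchar, h0]
    exact Ideal.span_singleton_eq_bot.mpr rfl
  rw [hchar] at hg
  obtain ⟨b, hb⟩ := Ideal.mem_span_singleton'.mp hg
  have hfac : g = fX * b := by rw [mul_comm, hb]
  have hb0 : b ≠ 0 := by rintro rfl; exact hg0 (by rw [hfac, mul_zero])
  have hμfX : mu fX = 0 := by
    have h := mu_le_mu_mul hfX0 hb0
    rw [← hfac, hμg] at h
    exact Nat.le_zero.mp h
  have hμX : D.mu = 0 := by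
    rw [SelmerDualData.mu, ← mu_generator_eq_muInvariant D.X hX hfX0 hchar]; exact hμfX
  have hlamX : D.lambda ≤ n := by
    have h1 : lam fX = D.lambda := lam_generator_eq_lambdaInvariant D.X hX hfX0 hchar
    have h2 : lam g = lam fX + lam b := by rw [hfac]; exact lam_mul hfX0 hb0
    have h3 : lam fX ≤ lam g := by rw [h2]; exact Nat.le_add_right _ _
    rw [← h1, ← hlamg]; exact h3
  -- Prop. 4.14@2 and the layer chain, as in §1
  have htors := not_two_dvd_torsionOrder_of_twoAdicSurjective W him
  have hnf : ∀ N : Submodule (IwasawaAlgebra 2) D.X, Finite N → N = ⊥ :=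
    fun N hN => h414 W 2 htors _ γ hκ hγ D hX N hN
  have hcard : Nat.card (D.X ⧸ (IwasawaAlgebra.augIdealP 2 • (⊤ : Submodule (IwasawaAlgebra 2) D.X))) =
      2 ^ lambdaInvariant 2 D.X :=
    Summit.BirchSwinnertonDyer.Rank1Residual.Additive.card_quotient_eq_pow_lambdaInvariant_holds 2 D.X hX hμX hnf
  have hfin : Finite (D.X ⧸ modPSubmodule 2 D.X) := TowerGap.finite_modP_of_isTorsion_of_mu_eq_zero 2 hX hμX
  have hle := TowerGap.natCard_quotient_towerIdeal_le_natCard_quotient_modP 2 hfin (2 ^ j)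
  have hmodP : Nat.card (D.X ⧸ modPSubmodule 2 D.X) = 2 ^ lambdaInvariant 2 D.X := hcard
  have hK := Iwasawa.forall_smul_eq_zero_imp_of_not_dvd_torsionOrder W htors
  have hsel := (finite_and_natCard_selmerLayer_pTorsion_le W (CyclotomicZp.zpExtension 2) D hK j).2
  calc Nat.card {z : W.selmerLayer (CyclotomicZp.zpExtension 2) j // 2 • z = 0}
      ≤ Nat.card (D.X ⧸ (towerIdeal 2 (2 ^ j) • ⊤ : Submodule (IwasawaAlgebra 2) D.X)) := hsel
    _ ≤ Nat.card (D.X ⧸ modPSubmodule 2 D.X) := hle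
    _ = 2 ^ lambdaInvariant 2 D.X := hmodP
    _ ≤ 2 ^ n := Nat.pow_le_pow_right (by norm_num) hlamX

end Summit.BirchSwinnertonDyer.BirchSwinnertonDyer.Theorems.MultSelmerRank

end
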